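import Mathlib
import Summits.Ventures.PercRepro2.ZMeanProof
import Summits.Ventures.PercRepro2.PendantRoot
import Summits.Ventures.PercRepro2.HMFLeaf
import Summits.Ventures.PercRepro2.HMFPendantRoot
import Summits.Ventures.PercRepro2.HMFTwoRootStar
import Summits.Ventures.PercRepro2.HMFTwoRootMass
import Summits.Ventures.PercRepro2.HMFTwoRootTransport
import Summits.Ventures.PercRepro2.RBDefs

/-!
# Row 2′RB at a two-root star, part 1: the Rao–Blackwell sum and the star masses
(blind cell PercRepro2, night-1 g7; NIGHT1-G7.md §7″)

Let `w` carry exactly the edges `f₁ = {w, a₁}`, `f₂ = {w, a₂}` (HMFTwoRootStar's star with the mark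
`w`).  Under `Q` the cluster of `w` is `{w}`, `{w} ∪ C₂` or `{w} ∪ C₁`; every Rao–Blackwell term
`P(Q ∩ cl A ∩ bL) P(Q ∩ cl A ∩ oH) / P(Q ∩ cl A)` other than the atom `A = {w}` is the exact joint
`P(Q ∩ cl A ∩ bL ∩ oH)` (`term_eq_joint`), so `rbSum(bL, oH) = atom + P(Q ∩ bL ∩ oH) − P(Q ∩ cl{w} ∩ bL ∩ oH)`
(`rbSum_eq`), and the star masses factor through the coins (`prob_atom_X`, `prob_atom`,
`prob_atom_joint`, `prob_Q_joint`).  Part 2 (RBStar.lean) closes the row with cross-cluster BHK.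
-/

namespace Summit.Ventures.PercRepro2

open UnionCluster CovForm PendantRoot HMFTwoRoot

namespace RBStar

open scoped Classical
variable {V : Type*} {E : Type*} [Fintype E] [DecidableEq E] [Fintype V] [DecidableEq V]
  {R : Type*} [Field R] [LinearOrder R] [IsStrictOrderedRing R]

variable (p : E → R) (ends : E → Sym2 V) {f₁ f₂ : E} {w a₁ a₂ : V}

section Clusters

variable {ends}

omit [Fintype E] [DecidableEq E] [Fintype V] [DecidableEq V] in
/-- If `f₂` is open, `a₂` lies in the cluster of `w`. -/
lemma mem_cluster_of_open₂ (hf₂ : ends f₂ = s(w, a₂)) {ω : Config E} (h2 : ω f₂ = true) :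
    a₂ ∈ cluster ends ω w :=
  conn_of_openAdj ⟨f₂, h2, hf₂⟩

omit [Fintype E] [DecidableEq E] [Fintype V] [DecidableEq V] in
/-- If `f₁` is open, `a₁` lies in the cluster of `w`. -/
lemma mem_cluster_of_open₁ (hf₁ : ends f₁ = s(w, a₁)) {ω : Config E} (h1 : ω f₁ = true) :
    a₁ ∈ cluster ends ω w :=
  conn_of_openAdj ⟨f₁, h1, hf₁⟩

omit [Fintype E] [Fintype V] [DecidableEq V] in
/-- A cluster of `w` avoiding both roots is `{w}`: the cluster event of any other such set is empty. -/
lemma clusterEvent_eq_empty_of_avoid (hf₁ : ends f₁ = s(w, a₁)) (hf₂ : ends f₂ = s(w, a₂))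
    (hstar : ∀ e, w ∈ ends e → e = f₁ ∨ e = f₂) {A : Set V} (h1 : a₁ ∉ A) (h2 : a₂ ∉ A)
    (hA : A ≠ {w}) : clusterEvent ends w A = ∅ := by
  ext ω
  simp only [mem_clusterEvent, Set.mem_empty_iff_false, iff_false]
  intro hc
  by_cases e1 : ω f₁ = true
  · exact h1 (hc ▸ mem_cluster_of_open₁ hf₁ e1)
  by_cases e2 : ω f₂ = true
  · exact h2 (hc ▸ mem_cluster_of_open₂ hf₂ e2)
  exact hA (hc ▸ cluster_a3_closed (f₁ := f₁) (f₂ := f₂) hstar (Bool.eq_false_iff.2 e1)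
    (Bool.eq_false_iff.2 e2))

omit [Fintype E] [Fintype V] [DecidableEq V] in
/-- The cluster event of `{w}` is `{both star edges closed}`. -/
lemma clusterEvent_singleton (hf₁ : ends f₁ = s(w, a₁)) (hf₂ : ends f₂ = s(w, a₂))
    (hstar : ∀ e, w ∈ ends e → e = f₁ ∨ e = f₂) (hw1 : w ≠ a₁) (hw2 : w ≠ a₂) :
    clusterEvent ends w ({w} : Set V) = closedEdge f₁ ∩ closedEdge f₂ := by
  ext ω
  simp only [mem_clusterEvent, Set.mem_inter_iff, mem_closedEdge]
  constructor
  · intro hc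
    constructor
    · by_contra e1
      have := mem_cluster_of_open₁ hf₁ (bool_true_of_ne_false e1)
      rw [hc] at this
      exact hw1 (Set.mem_singleton_iff.1 this).symm
    · by_contra e2
      have := mem_cluster_of_open₂ hf₂ (bool_true_of_ne_false e2)
      rw [hc] at this
      exact hw2 (Set.mem_singleton_iff.1 this).symm
  · rintro ⟨e1, e2⟩
    exact cluster_a3_closed (f₁ := f₁) (f₂ := f₂) hstar e1 e2

end Clusters

section Terms

variable {p ends}

omit [Fintype E] [DecidableEq E] [LinearOrder R] [IsStrictOrderedRing R] in
/-- Auxiliary: `x · y / z = x` when `y = z` (including `z = 0`, where both sides vanish if `x ≤ z`-type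
masses vanish — we only use the case `y = z`). -/
lemma mul_self_div_eq {x y : R} (hy : y ≠ 0) : x * y / y = x := by
  field_simp

omit [Fintype E] [DecidableEq E] [Fintype V] [DecidableEq V] in
/-- On a cluster of `w` containing the root `a₂`, the event `{o ↔ a₂}` is decided by the cluster. -/
lemma Qcl_inter_conn_of_mem₂ {A : Set V} (h2 : a₂ ∈ A) (o : V) :
    RB.Qst ends a₁ a₂ ∩ clusterEvent ends w A ∩ connEvent ends o a₂ =
      if o ∈ A then RB.Qst ends a₁ a₂ ∩ clusterEvent ends w A else ∅ := by
  rw [connEvent_comm ends o a₂, Set.inter_assoc]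
  split_ifs with ho
  · rw [cl_inter_conn_of_mem_mem ends w A h2 ho]
  · rw [cl_inter_conn_eq_empty' ends w A h2 ho, Set.inter_empty]

omit [Fintype E] [DecidableEq E] [Fintype V] [DecidableEq V] in
/-- On a cluster of `w` containing the root `a₁`, the event `{b ↔ a₁}` is decided by the cluster. -/
lemma Qcl_inter_conn_of_mem₁ {A : Set V} (h1 : a₁ ∈ A) (b : V) :
    RB.Qst ends a₁ a₂ ∩ clusterEvent ends w A ∩ connEvent ends b a₁ =
      if b ∈ A then RB.Qst ends a₁ a₂ ∩ clusterEvent ends w A else ∅ := by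
  rw [connEvent_comm ends b a₁, Set.inter_assoc]
  split_ifs with hb
  · rw [cl_inter_conn_of_mem_mem ends w A h1 hb]
  · rw [cl_inter_conn_eq_empty' ends w A h1 hb, Set.inter_empty]

omit [Fintype V] [DecidableEq V] in
/-- **Every non-atom term of the Rao–Blackwell sum is an exact joint mass.** For `A ≠ {w}`:
`P(Q ∩ cl A ∩ bL) P(Q ∩ cl A ∩ oH) / P(Q ∩ cl A) = P(Q ∩ cl A ∩ bL ∩ oH)`. -/
theorem term_eq_joint (hp : IsProbVec p) (hf₁ : ends f₁ = s(w, a₁)) (hf₂ : ends f₂ = s(w, a₂))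
    (hstar : ∀ e, w ∈ ends e → e = f₁ ∨ e = f₂) (o b : V) {A : Set V} (hA : A ≠ {w}) :
    prob p (RB.Qst ends a₁ a₂ ∩ clusterEvent ends w A ∩ connEvent ends b a₁) *
        prob p (RB.Qst ends a₁ a₂ ∩ clusterEvent ends w A ∩ connEvent ends o a₂) /
        prob p (RB.Qst ends a₁ a₂ ∩ clusterEvent ends w A) =
      prob p (RB.Qst ends a₁ a₂ ∩ clusterEvent ends w A ∩ connEvent ends b a₁ ∩ connEvent ends o a₂) := by
  by_cases h2 : a₂ ∈ A
  · have hoH := Qcl_inter_conn_of_mem₂ (ends := ends) (w := w) (a₁ := a₁) h2 o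
    have hR : RB.Qst ends a₁ a₂ ∩ clusterEvent ends w A ∩ connEvent ends b a₁ ∩ connEvent ends o a₂ =
        RB.Qst ends a₁ a₂ ∩ clusterEvent ends w A ∩ connEvent ends o a₂ ∩ connEvent ends b a₁ :=
      Set.inter_right_comm _ _ _
    rw [hR, hoH]
    split_ifs with ho
    · by_cases hz : prob p (RB.Qst ends a₁ a₂ ∩ clusterEvent ends w A) = 0
      · have h0 : prob p (RB.Qst ends a₁ a₂ ∩ clusterEvent ends w A ∩ connEvent ends b a₁) = 0 :=
          le_antisymm (by rw [← hz]; exact prob_mono hp Set.inter_subset_left) (prob_nonneg hp _)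
        rw [hz, h0]; simp
      · rw [mul_self_div_eq hz]
    · simp
  · by_cases h1 : a₁ ∈ A
    · have hbL := Qcl_inter_conn_of_mem₁ (ends := ends) (w := w) (a₂ := a₂) h1 b
      rw [hbL]
      split_ifs with hb
      · by_cases hz : prob p (RB.Qst ends a₁ a₂ ∩ clusterEvent ends w A) = 0
        · have h0 : prob p (RB.Qst ends a₁ a₂ ∩ clusterEvent ends w A ∩ connEvent ends o a₂) = 0 :=
            le_antisymm (by rw [← hz]; exact prob_mono hp Set.inter_subset_left) (prob_nonneg hp _)
          rw [hz, h0]; simp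
        · rw [mul_comm, mul_self_div_eq hz]
      · simp
    · rw [clusterEvent_eq_empty_of_avoid hf₁ hf₂ hstar h1 h2 hA]
      simp

end Terms


section Sum

variable {p ends}

omit [DecidableEq V] in
/-- **The Rao–Blackwell sum at a star**: the atom `{w}` plus the exact joint mass of the other rows. -/
theorem rbSum_eq (hp : IsProbVec p) (hf₁ : ends f₁ = s(w, a₁)) (hf₂ : ends f₂ = s(w, a₂))
    (hstar : ∀ e, w ∈ ends e → e = f₁ ∨ e = f₂) (o b : V) :
    RB.rbSum p ends a₁ a₂ w (connEvent ends b a₁) (connEvent ends o a₂) =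
      prob p (RB.Qst ends a₁ a₂ ∩ clusterEvent ends w ({w} : Set V) ∩ connEvent ends b a₁) *
          prob p (RB.Qst ends a₁ a₂ ∩ clusterEvent ends w ({w} : Set V) ∩ connEvent ends o a₂) /
          prob p (RB.Qst ends a₁ a₂ ∩ clusterEvent ends w ({w} : Set V)) +
        (prob p (RB.Qst ends a₁ a₂ ∩ connEvent ends b a₁ ∩ connEvent ends o a₂) -
          prob p (RB.Qst ends a₁ a₂ ∩ clusterEvent ends w ({w} : Set V) ∩ connEvent ends b a₁ ∩
            connEvent ends o a₂)) := by
  unfold RB.rbSum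
  rw [← Finset.add_sum_erase Finset.univ _ (Finset.mem_univ ({w} : Set V))]
  congr 1
  have hsum : ∑ A ∈ Finset.univ.erase ({w} : Set V),
      prob p (RB.Qst ends a₁ a₂ ∩ clusterEvent ends w A ∩ connEvent ends b a₁) *
          prob p (RB.Qst ends a₁ a₂ ∩ clusterEvent ends w A ∩ connEvent ends o a₂) /
          prob p (RB.Qst ends a₁ a₂ ∩ clusterEvent ends w A) =
      ∑ A ∈ Finset.univ.erase ({w} : Set V),
        prob p (RB.Qst ends a₁ a₂ ∩ connEvent ends b a₁ ∩ connEvent ends o a₂ ∩ clusterEvent ends w A) := by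
    refine Finset.sum_congr rfl fun A hA => ?_
    rw [term_eq_joint hp hf₁ hf₂ hstar o b (Finset.ne_of_mem_erase hA)]
    congr 1
    ext ω
    simp only [Set.mem_inter_iff]
    tauto
  rw [hsum, Finset.sum_erase_eq_sub (Finset.mem_univ _),
    RB.sum_prob_inter_clusterEvent p ends w (RB.Qst ends a₁ a₂ ∩ connEvent ends b a₁ ∩ connEvent ends o a₂)]
  congr 1
  congr 1
  ext ω
  simp only [Set.mem_inter_iff]
  tauto

end Sum

section Masses

variable {p ends}
variable (hf₁ : ends f₁ = s(w, a₁)) (hf₂ : ends f₂ = s(w, a₂))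
  (hstar : ∀ e, w ∈ ends e → e = f₁ ∨ e = f₂) (hw1 : w ≠ a₁) (hw2 : w ≠ a₂) (h12 : f₁ ≠ f₂)

omit [Fintype E] [DecidableEq E] [Fintype V] [DecidableEq V] in
/-- `Q` is `avoidAll` of the roots. -/
lemma Qst_eq_avoidAll : RB.Qst ends a₁ a₂ = avoidAll ends a₂ {a₁} := (avoidAll_eq_compl ends a₁ a₂).symm

omit [Fintype E] [Fintype V] [DecidableEq V] in
/-- Star-freeness of `Q₀ ∩ X₀ ∩ Y₀`. -/
lemma dependsOn_Q₀_two (x v y z : V) :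
    DependsOn (· ∈ Q₀ ends f₁ f₂ a₁ a₂ ∩ connEvent₀ ends f₁ f₂ x v ∩ connEvent₀ ends f₁ f₂ y z)
      ({f₁, f₂}ᶜ : Set E) := by
  have h := dependsOn_inter (dependsOn_Q₀_inter ends a₁ a₂ (dependsOn_connEvent₀ (ends := ends) (f₁ := f₁) (f₂ := f₂) x v))
    (dependsOn_connEvent₀ (ends := ends) (f₁ := f₁) (f₂ := f₂) y z)
  simpa only [Set.union_self] using h

include hf₁ hf₂ hstar hw1 hw2

omit [Fintype E] [Fintype V] [DecidableEq V] in
/-- `Q ∩ {C(w) = {w}}` is `Q₀ ∩ {both star edges closed}`. -/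
lemma Qst_inter_singleton :
    RB.Qst ends a₁ a₂ ∩ clusterEvent ends w ({w} : Set V) =
      Q₀ ends f₁ f₂ a₁ a₂ ∩ (closedEdge f₁ ∩ closedEdge f₂) := by
  rw [Qst_eq_avoidAll (ends := ends) (a₁ := a₁) (a₂ := a₂), avoidAll_star hf₁ hf₂ hstar hw1 hw2,
    clusterEvent_singleton hf₁ hf₂ hstar hw1 hw2]
  ext ω
  simp only [Set.mem_inter_iff, Set.mem_union]
  tauto

omit [Fintype E] [Fintype V] [DecidableEq V] hw1 hw2 in
/-- Two connection events among non-`w` vertices are the star-free ones off `{both open}`. -/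
lemma inter_two_conn_eq {S : Set (Config E)} (hS : ∀ ω ∈ S, ¬ (ω f₁ = true ∧ ω f₂ = true))
    {x v y z : V} (hx : x ≠ w) (hv : v ≠ w) (hy : y ≠ w) (hz : z ≠ w) :
    Q₀ ends f₁ f₂ a₁ a₂ ∩ S ∩ connEvent ends x v ∩ connEvent ends y z =
      (Q₀ ends f₁ f₂ a₁ a₂ ∩ connEvent₀ ends f₁ f₂ x v ∩ connEvent₀ ends f₁ f₂ y z) ∩ S := by
  ext ω
  simp only [Set.mem_inter_iff]
  constructor
  · rintro ⟨⟨⟨hQ, hS'⟩, h1⟩, h2⟩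
    exact ⟨⟨⟨hQ, (mem_conn_iff_conn₀ ends hf₁ hf₂ hstar hx hv (hS ω hS')).1 h1⟩,
      (mem_conn_iff_conn₀ ends hf₁ hf₂ hstar hy hz (hS ω hS')).1 h2⟩, hS'⟩
  · rintro ⟨⟨⟨hQ, h1⟩, h2⟩, hS'⟩
    exact ⟨⟨⟨hQ, hS'⟩, (mem_conn_iff_conn₀ ends hf₁ hf₂ hstar hx hv (hS ω hS')).2 h1⟩,
      (mem_conn_iff_conn₀ ends hf₁ hf₂ hstar hy hz (hS ω hS')).2 h2⟩

include h12

omit [Fintype V] [DecidableEq V] [LinearOrder R] [IsStrictOrderedRing R] in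
/-- The atom masses: `P(Q ∩ {C(w) = {w}} ∩ {x ↔ v}) = (1−α)(1−β) P(Q₀ ∩ {x ↔ v}₀)`. -/
lemma prob_atom_X {x v : V} (hx : x ≠ w) (hv : v ≠ w) :
    prob p (RB.Qst ends a₁ a₂ ∩ clusterEvent ends w ({w} : Set V) ∩ connEvent ends x v) =
      (1 - p f₁) * (1 - p f₂) * prob p (Q₀ ends f₁ f₂ a₁ a₂ ∩ connEvent₀ ends f₁ f₂ x v) := by
  rw [Qst_inter_singleton hf₁ hf₂ hstar hw1 hw2,
    prob_Q₀_state_inter p ends hf₁ hf₂ hstar hx hv _ (fun _ hω => nb_of_cc hω),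
    prob_inter_cc p h12 (dependsOn_Q₀_inter ends a₁ a₂ (dependsOn_connEvent₀ x v))]

omit [Fintype V] [DecidableEq V] [LinearOrder R] [IsStrictOrderedRing R] in
/-- `P(Q ∩ {C(w) = {w}}) = (1−α)(1−β) P(Q₀)`. -/
lemma prob_atom :
    prob p (RB.Qst ends a₁ a₂ ∩ clusterEvent ends w ({w} : Set V)) =
      (1 - p f₁) * (1 - p f₂) * prob p (Q₀ ends f₁ f₂ a₁ a₂) := by
  rw [Qst_inter_singleton hf₁ hf₂ hstar hw1 hw2, prob_inter_cc p h12 (dependsOn_Q₀ a₁ a₂)]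

omit [Fintype V] [DecidableEq V] [LinearOrder R] [IsStrictOrderedRing R] in
/-- The atom joint mass: `P(Q ∩ {C(w) = {w}} ∩ bL ∩ oH) = (1−α)(1−β) J`. -/
lemma prob_atom_joint {x v y z : V} (hx : x ≠ w) (hv : v ≠ w) (hy : y ≠ w) (hz : z ≠ w) :
    prob p (RB.Qst ends a₁ a₂ ∩ clusterEvent ends w ({w} : Set V) ∩ connEvent ends x v ∩ connEvent ends y z) =
      (1 - p f₁) * (1 - p f₂) *
        prob p (Q₀ ends f₁ f₂ a₁ a₂ ∩ connEvent₀ ends f₁ f₂ x v ∩ connEvent₀ ends f₁ f₂ y z) := by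
  rw [Qst_inter_singleton hf₁ hf₂ hstar hw1 hw2,
    inter_two_conn_eq hf₁ hf₂ hstar (fun _ hω => nb_of_cc hω) hx hv hy hz,
    prob_inter_cc p h12 (dependsOn_Q₀_two (ends := ends) (f₁ := f₁) (f₂ := f₂) (a₁ := a₁) (a₂ := a₂) x v y z)]

omit [Fintype V] [DecidableEq V] [LinearOrder R] [IsStrictOrderedRing R] in
/-- The total joint mass: `P(Q ∩ bL ∩ oH) = (1 − αβ) J`. -/
lemma prob_Q_joint {x v y z : V} (hx : x ≠ w) (hv : v ≠ w) (hy : y ≠ w) (hz : z ≠ w) :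
    prob p (RB.Qst ends a₁ a₂ ∩ connEvent ends x v ∩ connEvent ends y z) =
      (1 - p f₁ * p f₂) *
        prob p (Q₀ ends f₁ f₂ a₁ a₂ ∩ connEvent₀ ends f₁ f₂ x v ∩ connEvent₀ ends f₁ f₂ y z) := by
  rw [Qst_eq_avoidAll (ends := ends) (a₁ := a₁) (a₂ := a₂), avoidAll_star hf₁ hf₂ hstar hw1 hw2,
    inter_two_conn_eq hf₁ hf₂ hstar (fun _ hω => nb_of_nb hω) hx hv hy hz,
    prob_inter_nb p h12 (dependsOn_Q₀_two (ends := ends) (f₁ := f₁) (f₂ := f₂) (a₁ := a₁) (a₂ := a₂) x v y z)]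

end Masses


end RBStar

end Summit.Ventures.PercRepro2
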